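import Summits.CriticalPhenomena.PercolationContinuityZ3.Theorems.PercNearOneGluingNoHeavyQuantBlobLoad
import HarnessLib

/-!
# QUANT lane R8, T-DEC: the uniform-spreading load of n equal blobs IN BLOB UNITS — conjecture C as a `k`-free inequality on the
# Poisson-binomial masses `P_G(0..n)` (prim-quant-census-2 gen 82, file 5)

builds on p205010 (kernel theorem, internal audit signed; external expert review pending)

Support file (`--supports stmt-CriticalPhenomena-4575`), QUANT lane census seat prim-quant-census-2 (gen 82); memo
`run/shared/lean/prim/quant/prim-quant-census-2-g82/REFLECTION-G82.md` §3.  Theorems only, standard axioms, no sorries, no definitions.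

`heavy_blobLaw_of_load_le_one` (`…QuantBlobLoad`) reduces conjecture BLOB-AFL for a gate list `G` to the load inequality summed over ALL atoms
`l, h ≤ n·k` of the blob law.  Since that law lives on the multiples of `k` (`blobLaw_eq_zero_of_not_dvd`), the load is a `k`-FREE expression in the
Poisson-binomial masses `P_G(j) = blobLaw (G.map (k,·)) (j·k)`, `j = 0..n` (`S = ΣG`, `n = |G|`):
  **`L(G) = Σ_{j ≤ n, 2j < S} P_G(j) / Σ_{i ≤ n, i > S − j} P_G(i)·(1 − γ_{ji})/γ_{ji}`,  `γ_{ji} = max(S/n, (S − 2j)/(i − j))`.**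
* `sum_range_mul_eq_sum_multiples` — `Σ_{l ≤ n·k} f l = Σ_{j ≤ n} f (j·k)` for `f` vanishing off the multiples of `k ≥ 1`.
* `blobLoad_eq_unitLoad` — the load of `…QuantBlobLoad` equals `L(G)` above.
* **`heavy_blobLaw_of_unitLoad_le_one`** — `L(G) ≤ 1` ⟹ `blobLaw (G.map (k,·))` heavy at `(S/n, k·S)` (every `k ≥ 1`, every width);
  `decAtT_blobLaw_of_unitLoad_le_one`.  So CONJECTURE C reads: `L(G) ≤ 1` for every gate list with gates in `(0,1)` — a statement about the
  numbers `P_G(0), …, P_G(n)` and `S` only (census: memo §3; 0 violations).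

HONEST STATUS.  Reduction only; conjecture C / BLOB-AFL in the middle band beyond width 4 OPEN; `SiblingStep`, `FarTreeRow`, `GluedLemmaW`,
`GluedDominatedMass` OPEN; RATE class (log\*) / honest sentence of `run/shared/lean/prim/quant/README.md` unchanged.  [this work].  Nothing here is
cited as a published result.  The gluing rows served [cite: KozmaNitzan2024, Conjecture 3 (p. 15)]; product measure [cite: Grimmett1999, §1.3 p. 10].
-/

noncomputable section

open scoped BigOperators

namespace Summit.CriticalPhenomena.PercolationContinuityZ3.Theorems
namespace Quant

open Finset

/-- the two-point law `{lo, hi; g}` (as in `…QuantLawDEC`) -/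
local notation3 "TP[" lo ", " hi ", " g ", " h "]" =>
  (g : ℝ) * (if (h : ℕ) = (hi : ℕ) then (1 : ℝ) else 0) + (1 - (g : ℝ)) * (if (h : ℕ) = (lo : ℕ) then (1 : ℝ) else 0)

/-- the cheapest admissible gate of the pair `{l, h}` at floor `x`, target `T`: `max(x, (T − 2l)/(h − l))` -/
local notation3 "CG[" x ", " T ", " l ", " h "]" => max (x : ℝ) (((T : ℝ) - 2 * ((l : ℕ) : ℝ)) / (((h : ℕ) : ℝ) - ((l : ℕ) : ℝ)))

/-- the Poisson-binomial point mass `P_G(j)`: the law of the blobs `(k, g)`, `g ∈ G`, at the atom `j·k` -/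
local notation3 "PB[" k ", " G ", " j "]" => LawDec.blobLaw (List.map (fun g : ℝ => ((k : ℕ), g)) G) ((j : ℕ) * (k : ℕ))

namespace LawDec

/-- a sum over `{0..n·k}` of a function vanishing off the multiples of `k ≥ 1` is the sum over the multiples `j·k`, `j ≤ n`. [folklore] -/
theorem sum_range_mul_eq_sum_multiples (k : ℕ) (hk : 0 < k) (f : ℕ → ℝ) (hf : ∀ l, ¬ k ∣ l → f l = 0) :
    ∀ n : ℕ, ∑ l ∈ Finset.range (n * k + 1), f l = ∑ j ∈ Finset.range (n + 1), f (j * k)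
  | 0 => by simp
  | n + 1 => by
    rw [Finset.sum_range_succ (fun j => f (j * k)) (n + 1), ← sum_range_mul_eq_sum_multiples k hk f hf n,
      show (n + 1) * k + 1 = (n * k + 1) + k by ring, Finset.sum_range_add]
    congr 1
    -- in the block `n·k+1 .. (n+1)·k` the only multiple of `k` is the last entry
    rw [Finset.sum_eq_single (k - 1)]
    · congr 1
      have : 1 ≤ k := hk
      zify [this]
      ring
    · intro m hm hne
      have hmk : m < k := Finset.mem_range.1 hm
      apply hf
      intro hd
      have h1 : k ∣ n * k + 1 + m - n * k := Nat.dvd_sub hd (Dvd.intro_left n rfl)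
      rw [show n * k + 1 + m - n * k = m + 1 by omega] at h1
      have := Nat.le_of_dvd (Nat.succ_pos m) h1
      omega
    · intro h
      exact absurd (Finset.mem_range.2 (by omega)) h

/-- **THE LOAD IN BLOB UNITS.**  The uniform-spreading load of `blobLaw (G.map (k,·))` (`k ≥ 1`) summed over all atoms equals the `k`-free load
on the Poisson-binomial masses. [this work] -/
theorem blobLoad_eq_unitLoad (k : ℕ) (hk : 0 < k) (G : List ℝ) :
    (∑ l ∈ Finset.range (G.length * k + 1),
      (if 2 * (l : ℝ) < (k : ℝ) * G.sum then
        blobLaw (List.map (fun g : ℝ => (k, g)) G) l /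
          ∑ h ∈ Finset.range (G.length * k + 1),
            (if (k : ℝ) * G.sum - l < (h : ℝ) then
              blobLaw (List.map (fun g : ℝ => (k, g)) G) h * (1 - CG[G.sum / G.length, (k : ℝ) * G.sum, l, h])
                / CG[G.sum / G.length, (k : ℝ) * G.sum, l, h] else 0)
        else 0))
    = ∑ j ∈ Finset.range (G.length + 1),
      (if 2 * (j : ℝ) < G.sum then
        PB[k, G, j] /
          ∑ i ∈ Finset.range (G.length + 1),
            (if G.sum - j < (i : ℝ) then PB[k, G, i] * (1 - CG[G.sum / G.length, G.sum, j, i]) / CG[G.sum / G.length, G.sum, j, i]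
              else 0)
        else 0) := by
  have hk' : (0 : ℝ) < k := by exact_mod_cast hk
  have hdvd : ∀ p ∈ List.map (fun g : ℝ => (k, g)) G, k ∣ p.1 := by
    intro p hp; obtain ⟨g, _, rfl⟩ := List.mem_map.1 hp; exact dvd_rfl
  have hzero : ∀ l, ¬ k ∣ l → blobLaw (List.map (fun g : ℝ => (k, g)) G) l = 0 :=
    fun l hl => blobLaw_eq_zero_of_not_dvd k _ hdvd l hl
  -- outer sum: only the multiples of `k` contribute
  rw [sum_range_mul_eq_sum_multiples k hk _ (fun l hl => by rw [hzero l hl, zero_div, ite_self]) G.length]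
  refine Finset.sum_congr rfl fun j _ => ?_
  have hcond : (2 * ((j * k : ℕ) : ℝ) < (k : ℝ) * G.sum) ↔ (2 * (j : ℝ) < G.sum) := by
    push_cast
    constructor
    · intro h; nlinarith
    · intro h; nlinarith
  by_cases hj : 2 * (j : ℝ) < G.sum
  · rw [if_pos (hcond.2 hj), if_pos hj]
    congr 1
    -- inner sum: only the multiples of `k` contribute, and the pair data are `k`-free
    rw [sum_range_mul_eq_sum_multiples k hk _ (fun h hh => by rw [hzero h hh, zero_mul, zero_div, ite_self]) G.length]
    refine Finset.sum_congr rfl fun i _ => ?_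
    have hcond' : ((k : ℝ) * G.sum - ((j * k : ℕ) : ℝ) < ((i * k : ℕ) : ℝ)) ↔ (G.sum - j < (i : ℝ)) := by
      push_cast
      constructor
      · intro h; nlinarith
      · intro h; nlinarith
    have hgate : CG[G.sum / G.length, (k : ℝ) * G.sum, j * k, i * k] = CG[G.sum / G.length, G.sum, j, i] := by
      push_cast
      congr 1
      rw [show (k : ℝ) * G.sum - 2 * ((j : ℝ) * k) = k * (G.sum - 2 * j) by ring,
        show (i : ℝ) * k - (j : ℝ) * k = k * ((i : ℝ) - j) by ring]
      exact mul_div_mul_left _ _ hk'.ne'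
    by_cases hi : G.sum - j < (i : ℝ)
    · rw [if_pos (hcond'.2 hi), if_pos hi, hgate]
    · rw [if_neg (fun h => hi (hcond'.1 h)), if_neg hi]
  · rw [if_neg (fun h => hj (hcond.1 h)), if_neg hj]

/-- **n EQUAL BLOBS ARE HEAVY AT THEIR AVERAGE GATE AS SOON AS THE `k`-FREE LOAD IS `≤ 1`** (conjecture C in blob units ⟹ BLOB-AFL for the gate
list `G`, every width, every blob size `k ≥ 1`). [this work] -/
theorem heavy_blobLaw_of_unitLoad_le_one (k : ℕ) (hk : 0 < k) (G : List ℝ) (hG : ∀ g ∈ G, 0 < g ∧ g < 1) (hn : 0 < G.length)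
    (hload : ∑ j ∈ Finset.range (G.length + 1),
      (if 2 * (j : ℝ) < G.sum then
        PB[k, G, j] /
          ∑ i ∈ Finset.range (G.length + 1),
            (if G.sum - j < (i : ℝ) then PB[k, G, i] * (1 - CG[G.sum / G.length, G.sum, j, i]) / CG[G.sum / G.length, G.sum, j, i]
              else 0)
        else 0) ≤ 1) :
    ∃ (ι : Type) (_ : Fintype ι) (lam γ : ι → ℝ) (lo hi : ι → ℕ),
      (∀ i, 0 ≤ lam i) ∧ (∑ i, lam i = 1) ∧ (∀ i, 0 ≤ γ i ∧ γ i ≤ 1) ∧ (∀ i, lo i ≤ hi i) ∧ (∀ i, hi i ≤ G.length * k) ∧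
      (∀ h, blobLaw (List.map (fun g : ℝ => (k, g)) G) h = ∑ i, lam i * TP[lo i, hi i, γ i, h]) ∧
      (∀ i, 0 < lam i → G.sum / G.length ≤ γ i ∧ (k : ℝ) * G.sum ≤ 2 * (lo i : ℝ) + ((hi i : ℝ) - lo i) * γ i) :=
  heavy_blobLaw_of_load_le_one k hk G hG hn (by rw [blobLoad_eq_unitLoad k hk G]; exact hload)

/-- **hence DEC at every layer** under the `k`-free load hypothesis. [this work] -/
theorem decAtT_blobLaw_of_unitLoad_le_one (k : ℕ) (hk : 0 < k) (G : List ℝ) (hG : ∀ g ∈ G, 0 < g ∧ g < 1) (hn : 0 < G.length)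
    (hload : ∑ j ∈ Finset.range (G.length + 1),
      (if 2 * (j : ℝ) < G.sum then
        PB[k, G, j] /
          ∑ i ∈ Finset.range (G.length + 1),
            (if G.sum - j < (i : ℝ) then PB[k, G, i] * (1 - CG[G.sum / G.length, G.sum, j, i]) / CG[G.sum / G.length, G.sum, j, i]
              else 0)
        else 0) ≤ 1) (j : ℕ) :
    DECAtT (G.sum / G.length) ((k : ℝ) * G.sum) j (G.length * k) (blobLaw (List.map (fun g : ℝ => (k, g)) G)) :=
  decAtT_of_heavy _ _ _ _ (heavy_blobLaw_of_unitLoad_le_one k hk G hG hn hload) j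

end LawDec
end Quant
end Summit.CriticalPhenomena.PercolationContinuityZ3.Theorems
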